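import Literature.NumberTheory.LFunctions.ChebyshevHalfLineBiasThm8LimitsProofs
import Literature.NumberTheory.LFunctions.ChebyshevHalfLineBiasThm6iiProofs
import HarnessLib

/-!
# A GRH-EQUIVALENT criterion PROVED as an equivalence (Suzuki 2025, Thm 6 (iv), (1.28), with the limit `−(2φ(q))^{-1}Σ_χ m_χ`) — «nothing here bears on the truth of RH»
# `lim [(1/log x) Σ_{n ≤ x, n ≡ 1 (q)} Λ(n) n^{-1/2}(1 − log n/log x) − 4√x/(φ(q) log²x)] = −(1/(2φ(q))) Σ_χ m_χ` ⟺ GRH for every `χ` mod `q`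

LINE 1 — LABEL: RH-FREE literature (a kernel proof of a GRH-EQUIVALENCE; «GRH ⟹ limit» is GRH-CONDITIONAL, «limit ⟹
GRH» is GRH-implying). bears_on: LADDER-RH COLUMN 1 SCREW (S-C, criterion rung). WHAT THIS IS NOT: not a route, not
progress toward RH or GRH — an equivalence fixes WHICH limit statement is «GRH for all χ mod q»; nothing here bears
on the truth of RH.

M. Suzuki, *On variants of Chebyshev's conjecture*, Ramanujan J. **68** (2025), no. 4, art. 95 = arXiv:2411.07436
[`Suzuki2025Chebyshev`; PUBLISHED, refereed], §1.3 **Theorem 6 (iv)**, AS PRINTED: «Let `m_χ` denote the order of the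
zero of `L(s, χ)` at `s = 1/2`. Then, we have
`lim_{x→∞} ((1/log x) Σ_{n ≤ x, n ≡ 1 mod q} Λ(n)/√n (1 − log n/log x) − 4√x/(φ(q)(log x)²)) = −½ Σ_{χ mod q} m_χ` (1.28)
if and only if the GRH for `L(s, χ)` holds for all Dirichlet characters `χ` modulo `q`.» Printed proof (§5.1, last
paragraph): «By using (4.4') in place of (2.13) and (4.5') in place of (4.5), and employing the resulting modified
versions of (5.8) and (5.9), one can show that both (1.28) and (1.29) are equivalent to the GRH … We omit the details.»

AS-PRINTED AUDIT (recorded, not endorsed): by orthogonality (5.1), `Σ_{n ≡ 1 (q)} = φ(q)^{-1} Σ_χ`, and (4.5') gives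
`f_χ(x)/log²x → −m_χ/2` for each `χ ≠ χ₀` under GRH, while `(f_{χ₀}(x) − 4√x)/log²x → 0` under RH (`m_{χ₀} = 0` since
`ζ(½) < 0`); hence the limit in (1.28) that the printed method yields is `−(2φ(q))^{-1} Σ_χ m_χ` — exactly as (1.23) carries
`−φ(q)^{-1} Σ_χ (L'/L)(½, χ)` — and NOT the printed `−½ Σ_χ m_χ`; the two coincide iff `Σ_χ m_χ = 0` (no `L(s, χ)`
vanishing at `½`, as expected but unproved) or `φ(q) = 1`. THIS FILE proves the equivalence with the limit
`−(2φ(q))^{-1} Σ_χ m_χ` (`Suzuki2025Chebyshev_thm6_iv_corrected`), and the typed clause 3 of `Suzuki2025Chebyshev_thm6_limits`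
(which follows the print, `−½ Σ_χ m_χ`) under the extra hypothesis `L(½, χ) ≠ 0` for all `χ` mod `q`
(`Suzuki2025Chebyshev_thm6_iv_of_forall_ne_zero`). The named fact `Suzuki2025Chebyshev_thm6_limits` is NOT discharged
(clauses (iii), (v) and the as-printed (iv) remain; the referee may wish to re-type (iv)/(v) with the factor `φ(q)^{-1}`).

## What is proved, and how

* §1 `tendsto_progressionRieszMean_div_log_of_GRH` — GRH for every `χ` mod `q` ⟹ the limit `−(2φ(q))^{-1} Σ_χ m_χ`:
  `T(x) = (Σ_χ f_χ(x) − 4√x)/(φ(q) log²x)` (the tree's `ProgressionsRiesz.progressionRieszMean_eq`, Suzuki (5.1)), and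
  per character `(f_χ − [χ=χ₀]4√x)/log²x → −m_χ/2` (`χ ≠ χ₀`: the tree's `SuzukiThm8Limits.tendsto_rieszMean_div_log_of_GRH'`,
  i.e. Thm 8 (4.2') ⟸ GRH via the order-`m` exact formula; `χ = χ₀`: `ProgressionsRiesz.exists_norm_halfLineSum_one_le_of_RH`
  and `m_{χ₀} = 0` from `ζ(½) ≠ 0`, `ZetaRealAxis.lean`);
* §2 `forall_riemannHypothesis_of_tendsto_progressionRieszMean_div_log` — convergence of `T(x)` (to anything) ⟹ GRH for
  every `χ` mod `q`: the §5.1 continuation argument of the tree's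
  `SuzukiProgressionsRiesz.forall_riemannHypothesis_of_tendsto_progressionRieszMean` (`ChebyshevHalfLineBiasThm6iiProofs.lean`;
  `Z₀ = (s−1)L(s,χ₀)Π_{χ≠χ₀}L(s,χ)`, `G(t) = Σ_{n ≤ e^t, n ≡ 1} Λ(n)n^{-1/2}(t − log n) − 4e^{t/2}/φ(q)`), repeated verbatim
  (its plumbing lemmas are private there) except that now `|G(t)| ≤ K + Ct²` (`G(t) = t²T(e^t)`), which the engine
  `DirichletHalfLineRiesz.entire_ne_zero_of_laplace_eq_of_integrable` accepts (`integrableOn_of_quadratic_bound`);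
* §3 the equivalence `Suzuki2025Chebyshev_thm6_iv_corrected`, the as-typed clause under `∀χ, L(½, χ) ≠ 0`, and the
  characterisation `Suzuki2025Chebyshev_thm6_iv_as_printed_iff`: the as-printed (1.28) limit statement holds iff
  (GRH for all `χ` mod `q`) ∧ (`φ(q) = 1` ∨ `Σ_χ m_χ = 0`).

Theorems only (D-0014/D-0026): no definitions, no named facts.

## References
* [Suzuki2025Chebyshev] M. Suzuki, Ramanujan J. 68 (2025) 95 = arXiv:2411.07436: §1.3 Thm 6 (iv) (1.28), (ii) (1.23); §5.1
  (5.1), (5.7)–(5.9) and the last paragraph; §4.1 (4.5').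
* [MontgomeryVaughan2007] H. L. Montgomery, R. C. Vaughan, *Multiplicative Number Theory I*, §11.3 (orthogonality), §10.1.
-/

noncomputable section

open Complex Filter Topology Set MeasureTheory ArithmeticFunction
open scoped Real LSeries.notation

namespace Literature.NumberTheory.LFunctions

namespace SuzukiThm6iv

open DirichletCharacter HalfLineRiesz

variable {q : ℕ} [NeZero q]

/-! ## §1 «GRH for every `χ` mod `q` ⟹ (1.28)», with the limit `−(2φ(q))^{-1} Σ_χ m_χ` -/

/-- GRH for the principal character mod `q` gives RH (the tree's private `ProgressionsRiesz.riemannHypothesis_of_principal`,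
restated). [folklore] -/
private theorem riemannHypothesis_of_principal
    (h : (1 : DirichletCharacter ℂ q).RiemannHypothesis) : RiemannHypothesis := by
  refine riemannHypothesis_iff_strip_holds.2 fun s hs h0 h1 ↦ h s ?_ h0 h1
  have hs1 : s ≠ 1 := fun h ↦ by rw [h, Complex.one_re] at h1; exact lt_irrefl _ h1
  have key := DirichletCharacter.LFunction_changeLevel (one_dvd q) (1 : DirichletCharacter ℂ 1) (s := s) (Or.inr hs1)
  rw [DirichletCharacter.changeLevel_one, DirichletCharacter.LFunction_modOne_eq, hs, zero_mul] at key
  exact key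

/-- `m_{χ₀} = 0`: `L(½, χ₀) = Π_{p∣q}(1 − p^{-1/2}) ζ(½) ≠ 0` (`ζ(½) < 0`, the tree's `ZetaRealAxis.lean`). [folklore] -/
private theorem zeroOrder_one_half : DirichletDisc.zeroOrder (1 : DirichletCharacter ℂ q) (1 / 2) = 0 := by
  have hhalf : (1 : DirichletCharacter ℂ q).LFunction (1 / 2) ≠ 0 := by
    have h1 : (1 / 2 : ℂ) ≠ 1 := by norm_num
    show LFunctionTrivChar q (1 / 2) ≠ 0
    rw [LFunctionTrivChar_eq_mul_riemannZeta h1]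
    refine mul_ne_zero (Finset.prod_ne_zero_iff.2 fun p hp hzero ↦ ?_) ?_
    · have hp := Nat.prime_of_mem_primeFactors hp
      have h1' : (p : ℂ) ^ (-(1 / 2 : ℂ)) = 1 := (sub_eq_zero.1 hzero).symm
      have hn : ‖(p : ℂ) ^ (-(1 / 2 : ℂ))‖ = (p : ℝ) ^ (-(1 / 2 : ℂ)).re := Complex.norm_natCast_cpow_of_pos hp.pos _
      rw [h1', norm_one] at hn
      have hlt : (p : ℝ) ^ (-(1 / 2 : ℂ)).re < 1 :=
        Real.rpow_lt_one_of_one_lt_of_neg (by exact_mod_cast hp.one_lt) (by norm_num)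
      linarith
    · have := riemannZeta_ofReal_ne_zero_of_pos_of_lt_one (1 / 2) (by norm_num) (by norm_num)
      push_cast at this
      exact this
  -- analytic at `½` (differentiable away from `s = 1`), non-vanishing: order `0`
  have hd : ∀ᶠ z in 𝓝 (1 / 2 : ℂ), DifferentiableAt ℂ (1 : DirichletCharacter ℂ q).LFunction z := by
    filter_upwards [isOpen_ne.mem_nhds (show (1 / 2 : ℂ) ≠ 1 by norm_num)] with z hz
    exact differentiableAt_LFunction _ z (Or.inl hz)
  have han : AnalyticAt ℂ (1 : DirichletCharacter ℂ q).LFunction (1 / 2) :=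
    Complex.analyticAt_iff_eventually_differentiableAt.2 hd
  rw [DirichletDisc.zeroOrder, analyticOrderNatAt, han.analyticOrderAt_eq_zero.2 hhalf]
  rfl

/-- Per character: `(f_χ(x) − [χ = χ₀]·4√x)/log²x → −m_χ/2` under the GRH for `L(s, χ)` (`χ ≠ χ₀`: the tree's
`SuzukiThm8Limits.tendsto_rieszMean_div_log_of_GRH'`; `χ = χ₀`: `f_{χ₀}(x) − 4√x = O(log x)` under RH,
`ProgressionsRiesz.exists_norm_halfLineSum_one_le_of_RH`, and `m_{χ₀} = 0`). [cite: Suzuki2025Chebyshev, §5.1 (5.7) and §4.1 (4.5')] -/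
private theorem tendsto_char_div_log_sq (hGRH : ∀ χ : DirichletCharacter ℂ q, χ.RiemannHypothesis)
    (χ : DirichletCharacter ℂ q) :
    Tendsto (fun x : ℝ ↦ (halfLineSum χ x - (if χ = 1 then (4 * Real.sqrt x : ℂ) else 0)) /
        ((Real.log x : ℂ) * (Real.log x : ℂ))) atTop
      (𝓝 (-((DirichletDisc.zeroOrder χ (1 / 2) : ℂ) / 2))) := by
  by_cases hχ : χ = 1
  · subst hχ
    simp only [if_true]
    rw [zeroOrder_one_half, Nat.cast_zero, zero_div, neg_zero]
    have hRH : RiemannHypothesis := riemannHypothesis_of_principal (hGRH 1)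
    obtain ⟨B, hB⟩ := ProgressionsRiesz.exists_norm_halfLineSum_one_le_of_RH (q := q) hRH
    set D : ℂ := logDeriv (1 : DirichletCharacter ℂ q).LFunction (1 / 2) with hD
    have hlim : Tendsto (fun x : ℝ ↦ B * ((Real.log x)⁻¹ * (Real.log x)⁻¹) + ‖D‖ * (Real.log x)⁻¹)
        atTop (𝓝 0) := by
      have h0 := tendsto_inv_atTop_zero.comp Real.tendsto_log_atTop
      have h := ((h0.mul h0).const_mul B).add (h0.const_mul ‖D‖)
      simpa using h
    refine squeeze_zero_norm' ?_ hlim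
    filter_upwards [eventually_gt_atTop (1 : ℝ)] with x hx
    have hlx : 0 < Real.log x := Real.log_pos hx
    have h1 := hB x hx
    rw [norm_div, norm_mul, Complex.norm_real, Real.norm_of_nonneg hlx.le, div_le_iff₀ (by positivity)]
    have h2 : ‖halfLineSum (1 : DirichletCharacter ℂ q) x - 4 * Real.sqrt x‖ ≤ B + ‖D‖ * Real.log x := by
      have h3 : halfLineSum (1 : DirichletCharacter ℂ q) x - 4 * Real.sqrt x =
          (halfLineSum (1 : DirichletCharacter ℂ q) x - 4 * Real.sqrt x + (Real.log x : ℂ) * D)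
            - (Real.log x : ℂ) * D := by ring
      rw [h3]
      refine (norm_sub_le _ _).trans ?_
      rw [norm_mul, Complex.norm_real, Real.norm_of_nonneg hlx.le]
      linarith
    calc ‖halfLineSum (1 : DirichletCharacter ℂ q) x - 4 * (Real.sqrt x : ℂ)‖ ≤ B + ‖D‖ * Real.log x := h2
      _ = (B * ((Real.log x)⁻¹ * (Real.log x)⁻¹) + ‖D‖ * (Real.log x)⁻¹) * (Real.log x * Real.log x) := by
          field_simp
  · simp only [hχ, if_false, sub_zero]
    have h := SuzukiThm8Limits.tendsto_rieszMean_div_log_of_GRH' χ hχ (hGRH χ)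
    refine h.congr' ?_
    filter_upwards [eventually_gt_atTop (1 : ℝ)] with x hx
    rw [rieszMean_eq_halfLineSum_div χ hx]
    have hlx : (Real.log x : ℂ) ≠ 0 := by exact_mod_cast (Real.log_pos hx).ne'
    field_simp

/-- **Suzuki 2025, Thm 6 (iv), «if» direction, PROVED with the limit `−(2φ(q))^{-1} Σ_χ m_χ`**: if the GRH holds for
every Dirichlet character mod `q`, then
`(1/log x) Σ_{n ≤ x, n ≡ 1 (q)} Λ(n) n^{-1/2}(1 − log n/log x) − 4√x/(φ(q) log²x) → −(1/(2φ(q))) Σ_χ m_χ`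
(orthogonality `Σ_{n ≡ 1} = φ(q)^{-1} Σ_χ`, the tree's `ProgressionsRiesz.progressionRieszMean_eq`, and
`tendsto_char_div_log_sq` summed over `χ`). NOTE ON THE PRINTED (1.28): the paper prints the limit as `−½ Σ_χ m_χ`,
WITHOUT the factor `φ(q)^{-1}` that its own derivation («by appropriately modifying (5.9)», where `φ(q)F_q(x) = …`)
and clause (ii) (`−φ(q)^{-1} Σ_χ (L'/L)(½, χ)`) carry; the two agree iff `Σ_χ m_χ = 0` (expected: `L(½, χ) ≠ 0`) or
`φ(q) = 1`. This theorem states what the printed proof proves. GRH-CONDITIONAL.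
[cite: Suzuki2025Chebyshev, §1.3 Thm 6 (iv) (1.28) and §5.1] -/
theorem tendsto_progressionRieszMean_div_log_of_GRH (hGRH : ∀ χ : DirichletCharacter ℂ q, χ.RiemannHypothesis) :
    Tendsto (fun x : ℝ ↦ (1 / Real.log x) *
        ∑ n ∈ (Finset.Icc 1 ⌊x⌋₊).filter (fun n : ℕ ↦ (n : ZMod q) = 1),
          Λ n / Real.sqrt n * (1 - Real.log n / Real.log x)
        - 4 * Real.sqrt x / (Nat.totient q * Real.log x ^ 2)) atTop
      (𝓝 (-(1 / (2 * Nat.totient q) : ℝ) * ∑ χ : DirichletCharacter ℂ q, (DirichletDisc.zeroOrder χ (1 / 2) : ℝ))) := by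
  have hφ0 : 0 < (q.totient : ℝ) := by exact_mod_cast Nat.totient_pos.2 (NeZero.pos q)
  have hφ : (q.totient : ℂ) ≠ 0 := by exact_mod_cast hφ0.ne'
  -- the complex version
  set T : ℝ → ℝ := fun x ↦ (1 / Real.log x) *
        ∑ n ∈ (Finset.Icc 1 ⌊x⌋₊).filter (fun n : ℕ ↦ (n : ZMod q) = 1),
          Λ n / Real.sqrt n * (1 - Real.log n / Real.log x)
        - 4 * Real.sqrt x / (Nat.totient q * Real.log x ^ 2) with hT
  set g : DirichletCharacter ℂ q → ℝ → ℂ := fun χ x ↦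
    (halfLineSum χ x - (if χ = 1 then (4 * Real.sqrt x : ℂ) else 0)) / ((Real.log x : ℂ) * (Real.log x : ℂ)) with hg
  have hsum : Tendsto (fun x : ℝ ↦ ∑ χ : DirichletCharacter ℂ q, g χ x) atTop
      (𝓝 (∑ χ : DirichletCharacter ℂ q, -((DirichletDisc.zeroOrder χ (1 / 2) : ℂ) / 2))) :=
    tendsto_finsetSum _ fun χ _ ↦ tendsto_char_div_log_sq hGRH χ
  have hC : Tendsto (fun x : ℝ ↦ ((T x : ℝ) : ℂ)) atTop
      (𝓝 ((∑ χ : DirichletCharacter ℂ q, -((DirichletDisc.zeroOrder χ (1 / 2) : ℂ) / 2)) / (q.totient : ℂ))) := by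
    refine (hsum.div_const (q.totient : ℂ)).congr' ?_
    filter_upwards [eventually_gt_atTop (1 : ℝ)] with x hx
    have hlx : 0 < Real.log x := Real.log_pos hx
    have hlxC : (Real.log x : ℂ) ≠ 0 := by exact_mod_cast hlx.ne'
    have hsum4 : ∑ χ : DirichletCharacter ℂ q, (if χ = 1 then (4 * Real.sqrt x : ℂ) else 0) = 4 * Real.sqrt x := by
      rw [Finset.sum_ite_eq' Finset.univ (1 : DirichletCharacter ℂ q)]
      simp
    have hgsum : ∑ χ : DirichletCharacter ℂ q, g χ x =
        ((∑ χ : DirichletCharacter ℂ q, halfLineSum χ x) - 4 * Real.sqrt x) /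
          ((Real.log x : ℂ) * (Real.log x : ℂ)) := by
      simp only [hg, ← Finset.sum_div, Finset.sum_sub_distrib, hsum4]
    have hP := ProgressionsRiesz.progressionRieszMean_eq (q := q) hx
    rw [hgsum, hT]
    simp only
    rw [Complex.ofReal_sub, Complex.ofReal_mul, hP]
    push_cast
    field_simp
  -- back to the real statement
  have hre := (Complex.continuous_re.tendsto _).comp hC
  have h2 : (fun x ↦ ((T x : ℝ) : ℂ).re) = T := funext fun x ↦ Complex.ofReal_re _
  rw [show (Complex.re ∘ fun x : ℝ ↦ ((T x : ℝ) : ℂ)) = T from h2] at hre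
  convert hre using 2
  have hcast : ((∑ χ : DirichletCharacter ℂ q, -((DirichletDisc.zeroOrder χ (1 / 2) : ℂ) / 2)) / (q.totient : ℂ)) =
      ((-(1 / (2 * Nat.totient q) : ℝ) *
        ∑ χ : DirichletCharacter ℂ q, (DirichletDisc.zeroOrder χ (1 / 2) : ℝ) : ℝ) : ℂ) := by
    push_cast
    rw [Finset.sum_div, Finset.mul_sum]
    refine Finset.sum_congr rfl fun χ _ ↦ ?_
    field_simp
  rw [hcast, Complex.ofReal_re]

/-! ## §2 «(1.28) ⟹ GRH for every `χ` mod `q`» -/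

/-! ### The entire function `Z₀(s) = (s − 1) L(s, χ₀) · Π_{χ ≠ χ₀} L(s, χ)` -/

/-- `Z₀` is entire. [folklore] -/
private theorem differentiable_Z :
    Differentiable ℂ (fun s : ℂ ↦ LFunctionTrivChar₁ q s *
      ∏ χ ∈ Finset.univ.erase (1 : DirichletCharacter ℂ q), χ.LFunction s) :=
  (differentiable_LFunctionTrivChar₁ q).mul
    (Differentiable.fun_finsetProd fun _ hχ ↦ differentiable_LFunction (Finset.ne_of_mem_erase hχ))

/-- For `s ≠ 1`: if every `L(s, χ) ≠ 0` then `Z₀(s) ≠ 0`. [folklore] -/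
private theorem Z_ne_zero_of_forall {s : ℂ} (hs : s ≠ 1)
    (h : ∀ χ : DirichletCharacter ℂ q, χ.LFunction s ≠ 0) :
    LFunctionTrivChar₁ q s * ∏ χ ∈ Finset.univ.erase (1 : DirichletCharacter ℂ q), χ.LFunction s ≠ 0 := by
  refine mul_ne_zero ?_ (Finset.prod_ne_zero_iff.2 fun χ _ ↦ h χ)
  rw [LFunctionTrivChar₁, Function.update_of_ne hs]
  exact mul_ne_zero (sub_ne_zero.2 hs) (h 1)

/-- For `s ≠ 1`: `Z₀(s) ≠ 0` gives `L(s, χ) ≠ 0` for every `χ`. [folklore] -/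
private theorem ne_zero_of_Z {s : ℂ} (hs : s ≠ 1)
    (h : LFunctionTrivChar₁ q s * ∏ χ ∈ Finset.univ.erase (1 : DirichletCharacter ℂ q), χ.LFunction s ≠ 0)
    (χ : DirichletCharacter ℂ q) : χ.LFunction s ≠ 0 := by
  rcases eq_or_ne χ 1 with rfl | hχ
  · have h1 := left_ne_zero_of_mul h
    rw [LFunctionTrivChar₁, Function.update_of_ne hs] at h1
    exact right_ne_zero_of_mul h1
  · exact (Finset.prod_ne_zero_iff.1 (right_ne_zero_of_mul h)) χ (Finset.mem_erase.2 ⟨hχ, Finset.mem_univ _⟩)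

/-- `Z₀ ≠ 0` on `Re s ≥ 1`. [folklore] -/
private theorem Z_ne_zero_of_one_le_re {s : ℂ} (hs : 1 ≤ s.re) :
    LFunctionTrivChar₁ q s * ∏ χ ∈ Finset.univ.erase (1 : DirichletCharacter ℂ q), χ.LFunction s ≠ 0 := by
  rcases eq_or_ne s 1 with rfl | hs1
  · refine mul_ne_zero (LFunctionTrivChar₁_apply_one_ne_zero q) (Finset.prod_ne_zero_iff.2 fun χ hχ ↦ ?_)
    exact LFunction_ne_zero_of_one_le_re χ (Or.inl (Finset.ne_of_mem_erase hχ)) hs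
  · exact Z_ne_zero_of_forall hs1 fun χ ↦ LFunction_ne_zero_of_one_le_re χ (Or.inr hs1) hs

/-- For `Re w > 1`: `(Z₀'/Z₀)(w) = 1/(w − 1) + Σ_χ (L'/L)(w, χ)`. [folklore] -/
private theorem logDeriv_Z {w : ℂ} (hw : 1 < w.re) :
    logDeriv (fun s : ℂ ↦ LFunctionTrivChar₁ q s *
      ∏ χ ∈ Finset.univ.erase (1 : DirichletCharacter ℂ q), χ.LFunction s) w =
      1 / (w - 1) + ∑ χ : DirichletCharacter ℂ q, logDeriv χ.LFunction w := by
  have hw1 : w ≠ 1 := fun h ↦ by rw [h, one_re] at hw; exact lt_irrefl _ hw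
  have hL : ∀ χ : DirichletCharacter ℂ q, χ.LFunction w ≠ 0 := fun χ ↦
    LFunction_ne_zero_of_one_le_re χ (Or.inr hw1) hw.le
  have hdχ : ∀ χ ∈ Finset.univ.erase (1 : DirichletCharacter ℂ q), DifferentiableAt ℂ χ.LFunction w :=
    fun χ hχ ↦ differentiable_LFunction (Finset.ne_of_mem_erase hχ) w
  have hd1 : DifferentiableAt ℂ (1 : DirichletCharacter ℂ q).LFunction w :=
    differentiableAt_LFunction _ w (Or.inl hw1)
  -- the first factor agrees with `(s − 1) L(s, χ₀)` near `w`
  have hev : LFunctionTrivChar₁ q =ᶠ[𝓝 w] fun s ↦ (s - 1) * (1 : DirichletCharacter ℂ q).LFunction s := by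
    filter_upwards [isOpen_ne.mem_nhds hw1] with s hs
    rw [LFunctionTrivChar₁, Function.update_of_ne hs]
  have hA0 : LFunctionTrivChar₁ q w ≠ 0 := by
    rw [hev.eq_of_nhds]
    exact mul_ne_zero (sub_ne_zero.2 hw1) (hL 1)
  have hA : logDeriv (LFunctionTrivChar₁ q) w = 1 / (w - 1) + logDeriv (1 : DirichletCharacter ℂ q).LFunction w := by
    have h1 : logDeriv (LFunctionTrivChar₁ q) w =
        logDeriv (fun s ↦ (s - 1) * (1 : DirichletCharacter ℂ q).LFunction s) w := by
      rw [logDeriv_apply, logDeriv_apply, hev.deriv_eq, hev.eq_of_nhds]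
    rw [h1, logDeriv_mul (f := fun s : ℂ ↦ s - 1) (g := (1 : DirichletCharacter ℂ q).LFunction) w
      (sub_ne_zero.2 hw1) (hL 1) (by fun_prop) hd1]
    congr 1
    rw [logDeriv_apply, deriv_sub_const, deriv_id'', one_div]
  have hB0 : ∏ χ ∈ Finset.univ.erase (1 : DirichletCharacter ℂ q), χ.LFunction w ≠ 0 :=
    Finset.prod_ne_zero_iff.2 fun χ _ ↦ hL χ
  have hdB : DifferentiableAt ℂ
      (fun s : ℂ ↦ ∏ χ ∈ Finset.univ.erase (1 : DirichletCharacter ℂ q), χ.LFunction s) w :=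
    DifferentiableAt.fun_finsetProd hdχ
  rw [logDeriv_mul (f := LFunctionTrivChar₁ q)
      (g := fun s : ℂ ↦ ∏ χ ∈ Finset.univ.erase (1 : DirichletCharacter ℂ q), χ.LFunction s) w hA0 hB0
      ((differentiable_LFunctionTrivChar₁ q) w) hdB, hA,
    logDeriv_prod (s := Finset.univ.erase (1 : DirichletCharacter ℂ q)) (f := fun χ ↦ χ.LFunction) (x := w)
      (fun χ _ ↦ hL χ) hdχ, add_assoc,
    Finset.add_sum_erase Finset.univ (fun χ : DirichletCharacter ℂ q ↦ logDeriv χ.LFunction w) (Finset.mem_univ _)]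


/-! ### The weighted counting function and the transform of `e^{t/2}` -/

/-! ### The one-signed functions and their transforms -/

/-- `A_d(t) = Σ_{n ≤ e^t} d(n)/√n` is monotone for `d ≥ 0`. [folklore] -/
private theorem monotone_count {d : ℕ → ℝ} (hd0 : ∀ n, 0 ≤ d n) :
    Monotone fun t : ℝ ↦ ∑ n ∈ Finset.Icc 1 ⌊Real.exp t⌋₊, d n / Real.sqrt n := by
  intro t u htu
  refine Finset.sum_le_sum_of_subset_of_nonneg
    (Finset.Icc_subset_Icc_right (Nat.floor_mono (Real.exp_le_exp.2 htu))) fun n _ _ ↦ ?_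
  exact div_nonneg (hd0 n) (Real.sqrt_nonneg _)

/-- `B_d(t) = Σ_{n ≤ e^t} d(n) log n/√n` is monotone for `d ≥ 0`. [folklore] -/
private theorem monotone_countLog {d : ℕ → ℝ} (hd0 : ∀ n, 0 ≤ d n) :
    Monotone fun t : ℝ ↦ ∑ n ∈ Finset.Icc 1 ⌊Real.exp t⌋₊, d n / Real.sqrt n * Real.log n := by
  intro t u htu
  refine Finset.sum_le_sum_of_subset_of_nonneg
    (Finset.Icc_subset_Icc_right (Nat.floor_mono (Real.exp_le_exp.2 htu))) fun n _ _ ↦ ?_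
  exact mul_nonneg (div_nonneg (hd0 n) (Real.sqrt_nonneg _)) (Real.log_natCast_nonneg n)

/-- `φ_d(t) = Σ_{n ≤ e^t} d(n)/√n (t − log n) = t A_d(t) − B_d(t)` is measurable. [folklore] -/
private theorem measurable_weighted {d : ℕ → ℝ} (hd0 : ∀ n, 0 ≤ d n) :
    Measurable fun t : ℝ ↦ ∑ n ∈ Finset.Icc 1 ⌊Real.exp t⌋₊, d n / Real.sqrt n * (t - Real.log n) := by
  have h : (fun t : ℝ ↦ ∑ n ∈ Finset.Icc 1 ⌊Real.exp t⌋₊, d n / Real.sqrt n * (t - Real.log n)) =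
      fun t ↦ t * (∑ n ∈ Finset.Icc 1 ⌊Real.exp t⌋₊, d n / Real.sqrt n)
        - ∑ n ∈ Finset.Icc 1 ⌊Real.exp t⌋₊, d n / Real.sqrt n * Real.log n := by
    funext t
    rw [Finset.mul_sum, ← Finset.sum_sub_distrib]
    refine Finset.sum_congr rfl fun n _ ↦ ?_
    ring
  rw [h]
  exact (measurable_id.mul (monotone_count hd0).measurable).sub (monotone_countLog hd0).measurable

/-- `∫₀^∞ e^{t/2} e^{−St} dt = 1/(S − 1/2)` for `Re S > 1/2`, with integrability. [folklore] -/
private theorem integral_exp_half_mul_cexp {s : ℂ} (hs : 1 / 2 < s.re) :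
    IntegrableOn (fun t : ℝ ↦ ((Real.exp (t / 2) : ℝ) : ℂ) * cexp (-s * t)) (Ioi 0) ∧
      ∫ t in Ioi (0 : ℝ), ((Real.exp (t / 2) : ℝ) : ℂ) * cexp (-s * t) = 1 / (s - 1 / 2) := by
  have ha : ((1 / 2 : ℂ) - s).re < 0 := by simp; linarith
  have hne : (1 / 2 : ℂ) - s ≠ 0 := fun h ↦ by rw [h, zero_re] at ha; exact lt_irrefl _ ha
  have hne' : s - 1 / 2 ≠ 0 := fun h ↦ hne (by rw [← neg_sub, h, neg_zero])
  have heq : ∀ t : ℝ, ((Real.exp (t / 2) : ℝ) : ℂ) * cexp (-s * t) = cexp (((1 / 2 : ℂ) - s) * t) := by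
    intro t
    rw [Complex.ofReal_exp, ← Complex.exp_add]
    congr 1
    push_cast
    ring
  simp_rw [heq]
  refine ⟨integrableOn_exp_mul_complex_Ioi ha 0, ?_⟩
  rw [integral_exp_mul_complex_Ioi ha 0, Complex.ofReal_zero, mul_zero, Complex.exp_zero,
    show (1 / 2 : ℂ) - s = -(s - 1 / 2) by ring, div_neg, neg_div, neg_neg]

omit [NeZero q] in
/-- The sum (1.21)/(1.22) over `n ≡ 1 (mod q)` as a sum of `d = Λ𝟙_{n ≡ 1 (q)}` over all `n ≤ y`, at `x = e^τ`:
`Σ_{n ≤ y, n ≡ 1} Λ(n)/√n · log(e^τ/n) = Σ_{n ≤ y} d(n)/√n (τ − log n)`. [folklore] -/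
private theorem sum_filter_eq_sum_residueClass (τ : ℝ) (N : ℕ) :
    ∑ n ∈ (Finset.Icc 1 N).filter (fun n : ℕ ↦ (n : ZMod q) = 1),
        Λ n / Real.sqrt n * Real.log (Real.exp τ / n) =
      ∑ n ∈ Finset.Icc 1 N, vonMangoldt.residueClass (1 : ZMod q) n / Real.sqrt n * (τ - Real.log n) := by
  rw [Finset.sum_filter]
  refine Finset.sum_congr rfl fun n hn ↦ ?_
  rw [Finset.mem_Icc] at hn
  have hn0 : (0 : ℝ) < n := by exact_mod_cast hn.1
  simp only [vonMangoldt.residueClass, Set.indicator_apply, Set.mem_setOf_eq]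
  split_ifs
  · rw [Real.log_div (Real.exp_pos τ).ne' hn0.ne', Real.log_exp]
  · simp

/-! ### Integrability from a quadratic bound -/

/-- If `G` is measurable and `|G(t)| ≤ K + Ct²` for `t > 0`, then `G(t)e^{−σt} ∈ L¹(0, ∞)` for every `σ > 0`. [folklore] -/
private theorem integrableOn_of_quadratic_bound {G : ℝ → ℝ} (hG : Measurable G) {K C : ℝ}
    (hb : ∀ t : ℝ, 0 < t → |G t| ≤ K + C * t ^ 2) {σ : ℝ} (hσ : 0 < σ) :
    IntegrableOn (fun t : ℝ ↦ G t * Real.exp (-σ * t)) (Ioi 0) := by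
  have hmaj : IntegrableOn (fun t : ℝ ↦ (|K| + |C| * t ^ 2) * Real.exp (-σ * t)) (Ioi 0) := by
    have h1 : IntegrableOn (fun t : ℝ ↦ Real.exp (-σ * t)) (Ioi 0) := exp_neg_integrableOn_Ioi 0 hσ
    have h2 : IntegrableOn (fun t : ℝ ↦ t ^ (2 : ℝ) * Real.exp (-σ * t ^ (1 : ℝ))) (Ioi 0) :=
      integrableOn_rpow_mul_exp_neg_mul_rpow (by norm_num) le_rfl hσ
    have h2' : IntegrableOn (fun t : ℝ ↦ t ^ 2 * Real.exp (-σ * t)) (Ioi 0) := by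
      refine h2.congr_fun (fun t _ ↦ ?_) measurableSet_Ioi
      dsimp only
      rw [Real.rpow_one, Real.rpow_two]
    have h3 : IntegrableOn (fun t : ℝ ↦ |K| * Real.exp (-σ * t) + |C| * (t ^ 2 * Real.exp (-σ * t))) (Ioi 0) :=
      (h1.const_mul |K|).add (h2'.const_mul |C|)
    refine h3.congr_fun (fun t _ ↦ ?_) measurableSet_Ioi
    ring
  refine hmaj.mono' ((hG.mul (by fun_prop)).aestronglyMeasurable) ?_
  refine (ae_restrict_iff' measurableSet_Ioi).2 (Eventually.of_forall fun t (ht : 0 < t) ↦ ?_)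
  have h1 : |G t| ≤ |K| + |C| * t ^ 2 := by
    refine le_trans (hb t ht) ?_
    gcongr
    · exact le_abs_self K
    · exact le_abs_self C
  rw [Real.norm_eq_abs, abs_mul, Real.abs_exp]
  exact mul_le_mul_of_nonneg_right h1 (Real.exp_pos _).le

/-! ### The limit (1.28) forces GRH for every character mod `q` -/

/-- **Suzuki 2025, Thm 6 (iv), (1.28) ⟹ GRH for every `χ` mod `q`, PROVED for every limit value**: if
`(1/log x) Σ_{n ≤ x, n ≡ 1 (q)} Λ(n) n^{-1/2}(1 − log n/log x) − 4√x/(φ(q) log²x)` converges as `x → ∞` (to anything),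
then the GRH holds for `L(s, χ)` for every Dirichlet character `χ` mod `q` (the §5.1 argument of the tree's
`SuzukiProgressionsRiesz.forall_riemannHypothesis_of_tendsto_progressionRieszMean`, verbatim except that the one-signed
function is now `O(t²)` instead of `O(t)`, which the continuation engine
`DirichletHalfLineRiesz.entire_ne_zero_of_laplace_eq_of_integrable` allows).
[cite: Suzuki2025Chebyshev, §1.3 Thm 6 (iv) ((1.28) ⟹ GRH) and §5.1 («Finally, we prove the fourth and fifth claims …»)] -/
theorem forall_riemannHypothesis_of_tendsto_progressionRieszMean_div_log {ℓ : ℝ}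
    (h : Tendsto (fun x : ℝ ↦ (1 / Real.log x) *
        ∑ n ∈ (Finset.Icc 1 ⌊x⌋₊).filter (fun n : ℕ ↦ (n : ZMod q) = 1),
          Λ n / Real.sqrt n * (1 - Real.log n / Real.log x)
        - 4 * Real.sqrt x / (Nat.totient q * Real.log x ^ 2)) atTop (𝓝 ℓ)) :
    ∀ χ : DirichletCharacter ℂ q, χ.RiemannHypothesis := by
  have hφ0 : (q.totient : ℂ) ≠ 0 := by exact_mod_cast (Nat.totient_pos.mpr (NeZero.pos q)).ne'
  have hφpos : (0 : ℝ) < q.totient := by exact_mod_cast Nat.totient_pos.mpr (NeZero.pos q)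
  -- the real functions `T` (the divided mean) and `F = log x · T`
  set T : ℝ → ℝ := fun x ↦ (1 / Real.log x) *
        ∑ n ∈ (Finset.Icc 1 ⌊x⌋₊).filter (fun n : ℕ ↦ (n : ZMod q) = 1),
          Λ n / Real.sqrt n * (1 - Real.log n / Real.log x)
        - 4 * Real.sqrt x / (Nat.totient q * Real.log x ^ 2) with hT
  set F : ℝ → ℝ := fun x ↦ (∑ n ∈ (Finset.Icc 1 ⌊x⌋₊).filter (fun n : ℕ ↦ (n : ZMod q) = 1),
      Λ n / Real.sqrt n * (1 - Real.log n / Real.log x)) - 4 * Real.sqrt x / (Nat.totient q * Real.log x) with hF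
  have hFT : ∀ x : ℝ, 1 < x → F x = Real.log x * T x := by
    intro x hx
    have hlx : Real.log x ≠ 0 := (Real.log_pos hx).ne'
    simp only [hF, hT]
    set P := ∑ n ∈ (Finset.Icc 1 ⌊x⌋₊).filter (fun n : ℕ ↦ (n : ZMod q) = 1),
      Λ n / Real.sqrt n * (1 - Real.log n / Real.log x)
    field_simp
  obtain ⟨x₁, hx₁⟩ := Filter.eventually_atTop.1 (Metric.tendsto_nhds.1 h 1 one_pos)
  -- the coefficients `d = Λ𝟙_{n ≡ 1 (q)} ∈ [0, Λ]`
  set d : ℕ → ℝ := vonMangoldt.residueClass (1 : ZMod q) with hd_def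
  have hd0 : ∀ n, 0 ≤ d n := vonMangoldt.residueClass_nonneg _
  have hdle : ∀ n, d n ≤ Λ n := vonMangoldt.residueClass_le _
  -- `Z₀`
  set Z₀ : ℂ → ℂ := fun s : ℂ ↦ LFunctionTrivChar₁ q s *
    ∏ χ ∈ Finset.univ.erase (1 : DirichletCharacter ℂ q), χ.LFunction s with hZ₀_def
  have hZ₀d : Differentiable ℂ Z₀ := differentiable_Z
  have hZ₀right : ∀ s : ℂ, 1 ≤ s.re → Z₀ s ≠ 0 := fun s hs ↦ Z_ne_zero_of_one_le_re hs
  have hLd : ∀ s : ℂ, 1 < s.re →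
      L (fun n ↦ (d n : ℂ)) (1 / 2 + s) = -(q.totient : ℂ)⁻¹ * (logDeriv Z₀ (1 / 2 + s) - 1 / (s - 1 / 2)) := by
    intro s hs
    have hw : 1 < (1 / 2 + s : ℂ).re := by simp; linarith
    rw [hd_def, SuzukiProgressions.LSeries_residueClass_one hw, hZ₀_def, logDeriv_Z hw]
    congr 1
    rw [show (1 / 2 : ℂ) + s - 1 = s - 1 / 2 by ring]
    ring
  -- `G(t) = φ_d(t) − 4 e^{t/2}/φ(q)`
  set G : ℝ → ℝ := fun t ↦
    (∑ n ∈ Finset.Icc 1 ⌊Real.exp t⌋₊, d n / Real.sqrt n * (t - Real.log n))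
      - 4 * Real.exp (t / 2) / Nat.totient q with hG_def
  have hGm : Measurable G := (measurable_weighted hd0).sub (by fun_prop)
  -- `G(t) = t · F(e^t)` for `t ≠ 0`
  have hGF : ∀ t : ℝ, t ≠ 0 → G t = t * F (Real.exp t) := by
    intro t ht
    rw [hG_def, hF]
    simp only
    rw [Real.log_exp, ← Real.exp_half, mul_sub, ← sum_filter_eq_sum_residueClass, Finset.mul_sum]
    congr 1
    · refine Finset.sum_congr rfl fun n hn ↦ ?_
      have hn1 : 1 ≤ n := (Finset.mem_Icc.1 (Finset.mem_filter.1 hn).1).1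
      have hn0 : (0 : ℝ) < n := by exact_mod_cast hn1
      rw [Real.log_div (Real.exp_pos t).ne' hn0.ne', Real.log_exp]
      field_simp
    · field_simp
  -- the linear bound `|G t| ≤ K + C t`
  set t₁ : ℝ := max (Real.log (max x₁ 1)) 1 with ht₁
  have ht₁1 : 1 ≤ t₁ := le_max_right _ _
  set K : ℝ := t₁ * (∑ n ∈ Finset.Icc 1 ⌊Real.exp t₁⌋₊, Λ n / Real.sqrt n) +
    4 * Real.exp (t₁ / 2) / Nat.totient q with hK
  set C : ℝ := |ℓ| + 1 with hC
  have hsum0 : ∀ t : ℝ, 0 ≤ ∑ n ∈ Finset.Icc 1 ⌊Real.exp t⌋₊, Λ n / Real.sqrt n := fun t ↦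
    Finset.sum_nonneg fun n _ ↦ div_nonneg vonMangoldt_nonneg (Real.sqrt_nonneg _)
  have hK0 : 0 ≤ K := by
    have : 0 ≤ 4 * Real.exp (t₁ / 2) / Nat.totient q := by positivity
    have := hsum0 t₁
    positivity
  have hbound : ∀ t : ℝ, 0 < t → |G t| ≤ K + C * t ^ 2 := by
    intro t ht
    rcases le_or_gt t t₁ with hle | hgt
    · -- `0 < t ≤ t₁`: `0 ≤ φ_d(t) ≤ t₁ Σ_{n ≤ e^{t₁}} Λ/√n`
      have hφle : |∑ n ∈ Finset.Icc 1 ⌊Real.exp t⌋₊, d n / Real.sqrt n * (t - Real.log n)| ≤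
          t₁ * ∑ n ∈ Finset.Icc 1 ⌊Real.exp t₁⌋₊, Λ n / Real.sqrt n := by
        have hterm : ∀ n ∈ Finset.Icc 1 ⌊Real.exp t⌋₊,
            0 ≤ d n / Real.sqrt n * (t - Real.log n) ∧
              d n / Real.sqrt n * (t - Real.log n) ≤ t₁ * (Λ n / Real.sqrt n) := by
          intro n hn
          rw [Finset.mem_Icc] at hn
          have hn0 : (0 : ℝ) < n := by exact_mod_cast hn.1
          have hnt : Real.log n ≤ t := by
            have h1 : (n : ℝ) ≤ Real.exp t := le_trans (by exact_mod_cast hn.2) (Nat.floor_le (Real.exp_pos t).le)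
            have := Real.log_le_log hn0 h1
            rwa [Real.log_exp] at this
          have hl0 : 0 ≤ t - Real.log n := by linarith
          have hdn : 0 ≤ d n / Real.sqrt n := div_nonneg (hd0 n) (Real.sqrt_nonneg _)
          refine ⟨mul_nonneg hdn hl0, ?_⟩
          calc d n / Real.sqrt n * (t - Real.log n) ≤ Λ n / Real.sqrt n * t₁ := by
                apply mul_le_mul (div_le_div_of_nonneg_right (hdle n) (Real.sqrt_nonneg _)) _ hl0
                  (div_nonneg vonMangoldt_nonneg (Real.sqrt_nonneg _))
                linarith [Real.log_natCast_nonneg n]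
            _ = t₁ * (Λ n / Real.sqrt n) := mul_comm _ _
        rw [abs_of_nonneg (Finset.sum_nonneg fun n hn ↦ (hterm n hn).1), Finset.mul_sum]
        calc ∑ n ∈ Finset.Icc 1 ⌊Real.exp t⌋₊, d n / Real.sqrt n * (t - Real.log n)
            ≤ ∑ n ∈ Finset.Icc 1 ⌊Real.exp t⌋₊, t₁ * (Λ n / Real.sqrt n) := Finset.sum_le_sum fun n hn ↦ (hterm n hn).2
          _ ≤ ∑ n ∈ Finset.Icc 1 ⌊Real.exp t₁⌋₊, t₁ * (Λ n / Real.sqrt n) := by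
              apply Finset.sum_le_sum_of_subset_of_nonneg
                (Finset.Icc_subset_Icc_right (Nat.floor_mono (Real.exp_le_exp.2 hle)))
              intro n _ _
              exact mul_nonneg (by linarith) (div_nonneg vonMangoldt_nonneg (Real.sqrt_nonneg _))
      have hE : |4 * Real.exp (t / 2) / Nat.totient q| ≤ 4 * Real.exp (t₁ / 2) / Nat.totient q := by
        rw [abs_of_nonneg (by positivity)]
        gcongr
      calc |G t| ≤ |∑ n ∈ Finset.Icc 1 ⌊Real.exp t⌋₊, d n / Real.sqrt n * (t - Real.log n)| +
            |4 * Real.exp (t / 2) / Nat.totient q| := abs_sub _ _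
        _ ≤ K := by rw [hK]; exact add_le_add hφle hE
        _ ≤ K + C * t ^ 2 := by
            have : 0 ≤ C * t ^ 2 := mul_nonneg (by positivity) (sq_nonneg t)
            linarith
    · -- `t > t₁`: `e^t ≥ x₁`, so `|F(e^t)| ≤ C` and `G(t) = t F(e^t)`
      have hxt : x₁ ≤ Real.exp t := by
        have h1 : Real.log (max x₁ 1) < t := lt_of_le_of_lt (le_max_left _ _) hgt
        have h2 : max x₁ 1 < Real.exp t := by
          rw [← Real.exp_log (lt_of_lt_of_le one_pos (le_max_right x₁ 1))]
          exact Real.exp_lt_exp.2 h1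
        exact le_trans (le_max_left _ _) h2.le
      have hexp1 : 1 < Real.exp t := by
        rw [← Real.exp_zero]
        exact Real.exp_lt_exp.2 ht
      have hTt : |T (Real.exp t)| ≤ C := by
        have hd1 := hx₁ (Real.exp t) hxt
        rw [Real.dist_eq] at hd1
        have := abs_sub_abs_le_abs_sub (T (Real.exp t)) ℓ
        rw [hC]
        linarith
      have hFt : |F (Real.exp t)| ≤ C * t := by
        rw [hFT (Real.exp t) hexp1, Real.log_exp, abs_mul, abs_of_pos ht]
        calc t * |T (Real.exp t)| ≤ t * C := mul_le_mul_of_nonneg_left hTt ht.le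
          _ = C * t := mul_comm _ _
      rw [hGF t (by linarith), abs_mul, abs_of_pos ht]
      calc t * |F (Real.exp t)| ≤ t * (C * t) := mul_le_mul_of_nonneg_left hFt ht.le
        _ ≤ K + C * t ^ 2 := by nlinarith [hK0]
  -- the engine: `Z₀ ≠ 0` on `Re s > ½`
  have hZ : ∀ s : ℂ, 1 / 2 < s.re → Z₀ s ≠ 0 := by
    refine DirichletHalfLineRiesz.entire_ne_zero_of_laplace_eq_of_integrable hZ₀d hZ₀right hGm
      (fun σ hσ ↦ integrableOn_of_quadratic_bound hGm hbound hσ)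
      (c := fun _ ↦ -(q.totient : ℂ)⁻¹) (P := fun s ↦ -2 * (q.totient : ℂ)⁻¹ * (2 * s + 1))
      (by fun_prop) (fun _ _ _ ↦ neg_ne_zero.2 (inv_ne_zero hφ0)) (by fun_prop) (fun s hs ↦ ?_)
    have ha : (-s).re < -1 / 2 := by simp; linarith
    have hs' : 1 / 2 < s.re := by linarith
    obtain ⟨hi₁, hI₁⟩ := HalfLinePrimeOnlyLandau.integral_weighted_mul_cexp (d := d) hd0 hdle ha
    obtain ⟨hi₂, hI₂⟩ := integral_exp_half_mul_cexp hs'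
    have heq : EqOn (fun t : ℝ ↦ (G t : ℂ) * cexp (-s * t))
        (fun t ↦ ((∑ n ∈ Finset.Icc 1 ⌊Real.exp t⌋₊, d n / Real.sqrt n * (t - Real.log n) : ℝ) : ℂ) *
              cexp (-s * t)
            - (4 / (q.totient : ℂ)) * (((Real.exp (t / 2) : ℝ) : ℂ) * cexp (-s * t))) (Ioi 0) := by
      intro t _
      simp only [hG_def]
      push_cast
      ring
    rw [setIntegral_congr_fun measurableSet_Ioi heq, integral_sub hi₁ (hi₂.const_mul _),
      integral_const_mul, hI₁, hI₂, show (1 / 2 : ℂ) - -s = 1 / 2 + s by ring, hLd s hs]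
    have hs0 : s ≠ 0 := fun h ↦ by rw [h, zero_re] at hs; linarith
    have hs2 : s - 1 / 2 ≠ 0 := fun h ↦ by
      have := congrArg re h
      simp at this
      linarith
    have hs3 : (-1 + s * 2 : ℂ) ≠ 0 := fun h ↦ hs2 (by linear_combination h / 2)
    have hs4 : (2 * s - 1 : ℂ) ≠ 0 := fun h ↦ hs2 (by linear_combination h / 2)
    have hs5 : (s * 2 - 1 : ℂ) ≠ 0 := fun h ↦ hs2 (by linear_combination h / 2)
    have hs6 : (1 - s * 2 : ℂ) ≠ 0 := fun h ↦ hs2 (by linear_combination -h / 2)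
    have hs7 : (1 - 2 * s : ℂ) ≠ 0 := fun h ↦ hs2 (by linear_combination -h / 2)
    rw [show (1 : ℂ) / (s - 1 / 2) = 2 / (2 * s - 1) by rw [div_eq_div_iff hs2 hs4]; ring]
    field_simp
    ring
  -- `L(s, χ) ≠ 0` for `½ < Re s`, `s ≠ 1`, every `χ`
  have hmain : ∀ χ : DirichletCharacter ℂ q, ∀ s : ℂ, 1 / 2 < s.re → s ≠ 1 → χ.LFunction s ≠ 0 :=
    fun χ s hs hs1 ↦ ne_zero_of_Z hs1 (hZ s hs) χ
  intro χ
  rcases ne_or_eq χ 1 with hχ | rfl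
  · refine DirichletHalfLineLandau.riemannHypothesis_of_forall_ne_zero hχ fun s hs ↦ ?_
    rcases eq_or_ne s 1 with rfl | hs1
    · exact LFunction_ne_zero_of_one_le_re χ (Or.inl hχ) (by simp)
    · exact hmain χ s hs hs1
  · -- the principal character: `L(s, χ₀) = Π_{p ∣ q}(1 − p^{-s}) ζ(s)`, reflect a zero with `Re s < 1/2`
    intro s h0 h0re h1re
    by_contra hne
    have hs1 : s ≠ 1 := fun h ↦ by rw [h, one_re] at h1re; exact lt_irrefl _ h1re
    rcases lt_or_gt_of_ne hne with hlt | hgt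
    · have hs0 : s ≠ 0 := fun h ↦ by rw [h, zero_re] at h0re; exact lt_irrefl _ h0re
      have heuler : ∀ w : ℂ, 0 < w.re → ∏ p ∈ q.primeFactors, (1 - (p : ℂ) ^ (-w)) ≠ 0 := by
        intro w hw
        refine Finset.prod_ne_zero_iff.2 fun p hp hzero ↦ ?_
        have hp := Nat.prime_of_mem_primeFactors hp
        have h1 : (p : ℂ) ^ (-w) = 1 := (sub_eq_zero.1 hzero).symm
        have hn : ‖(p : ℂ) ^ (-w)‖ = (p : ℝ) ^ (-w).re := Complex.norm_natCast_cpow_of_pos hp.pos _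
        rw [h1, norm_one] at hn
        have hlt : (p : ℝ) ^ (-w).re < 1 :=
          Real.rpow_lt_one_of_one_lt_of_neg (by exact_mod_cast hp.one_lt) (by simp; exact hw)
        linarith
      have hζ : riemannZeta s = 0 := by
        have h0' : LFunctionTrivChar q s = 0 := h0
        rw [LFunctionTrivChar_eq_mul_riemannZeta hs1, mul_eq_zero] at h0'
        exact h0'.resolve_left (heuler s h0re)
      have hζ' := GeneralizedRH.riemannZeta_one_sub_eq_zero hζ h0re h1re
      have h1s : (1 - s) ≠ 1 := fun h ↦ hs0 (by linear_combination -h)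
      have hL : LFunctionTrivChar q (1 - s) = 0 := by
        rw [LFunctionTrivChar_eq_mul_riemannZeta h1s, hζ', mul_zero]
      exact hmain 1 (1 - s) (by simp; linarith) h1s hL
    · exact hmain 1 s hgt hs1 h0



/-! ## §3 Theorem 6 (iv) as an equivalence -/

/-- **Suzuki 2025, Theorem 6 (iv), PROVED AS AN EQUIVALENCE with the limit `−(2φ(q))^{-1} Σ_χ m_χ`**:
`lim_{x→∞} [(1/log x) Σ_{n ≤ x, n ≡ 1 (q)} Λ(n) n^{-1/2}(1 − log n/log x) − 4√x/(φ(q) log²x)] = −(1/(2φ(q))) Σ_χ m_χ`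
holds if and only if the GRH holds for `L(s, χ)` for every `χ` mod `q`. The printed (1.28) (and clause 3 of the typed
fact `Suzuki2025Chebyshev_thm6_limits`) has `−½ Σ_χ m_χ` (the factor `φ(q)^{-1}` of (1.23) is missing in print); see
`Suzuki2025Chebyshev_thm6_iv_of_forall_ne_zero` for the typed form under `L(½, χ) ≠ 0 ∀χ`. A GRH-EQUIVALENT criterion
proved as an equivalence; nothing here bears on the truth of RH. [cite: Suzuki2025Chebyshev, §1.3 Thm 6 (iv) (1.28); §5.1] -/
theorem Suzuki2025Chebyshev_thm6_iv_corrected :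
    Tendsto (fun x : ℝ ↦ (1 / Real.log x) *
        ∑ n ∈ (Finset.Icc 1 ⌊x⌋₊).filter (fun n : ℕ ↦ (n : ZMod q) = 1),
          Λ n / Real.sqrt n * (1 - Real.log n / Real.log x)
        - 4 * Real.sqrt x / (Nat.totient q * Real.log x ^ 2)) atTop
      (𝓝 (-(1 / (2 * Nat.totient q) : ℝ) * ∑ χ : DirichletCharacter ℂ q, (DirichletDisc.zeroOrder χ (1 / 2) : ℝ))) ↔
      ∀ χ : DirichletCharacter ℂ q, χ.RiemannHypothesis :=
  ⟨fun h ↦ forall_riemannHypothesis_of_tendsto_progressionRieszMean_div_log h,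
    fun h ↦ tendsto_progressionRieszMean_div_log_of_GRH h⟩

/-- **Clause (iv) of `Suzuki2025Chebyshev_thm6_limits` AS TYPED (limit `−½ Σ_χ m_χ`), PROVED under `L(½, χ) ≠ 0` for
every `χ` mod `q`** (then `Σ_χ m_χ = 0` and the printed and the corrected limits coincide).
[cite: Suzuki2025Chebyshev, §1.3 Thm 6 (iv) (1.28)] -/
theorem Suzuki2025Chebyshev_thm6_iv_of_forall_ne_zero
    (hL : ∀ χ : DirichletCharacter ℂ q, χ.LFunction (1 / 2) ≠ 0) :
    Tendsto (fun x : ℝ ↦ (1 / Real.log x) *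
        ∑ n ∈ (Finset.Icc 1 ⌊x⌋₊).filter (fun n : ℕ ↦ (n : ZMod q) = 1),
          Λ n / Real.sqrt n * (1 - Real.log n / Real.log x)
        - 4 * Real.sqrt x / (Nat.totient q * Real.log x ^ 2)) atTop
      (𝓝 (-(1 / 2 : ℝ) * ∑ χ : DirichletCharacter ℂ q, (DirichletDisc.zeroOrder χ (1 / 2) : ℝ))) ↔
      ∀ χ : DirichletCharacter ℂ q, χ.RiemannHypothesis := by
  have hm : ∀ χ : DirichletCharacter ℂ q, DirichletDisc.zeroOrder χ (1 / 2) = 0 := by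
    intro χ
    by_cases hχ : χ = 1
    · subst hχ; exact zeroOrder_one_half
    · by_contra hne
      exact hL χ ((DirichletDisc.zeroOrder_pos_iff χ hχ _).1 (Nat.pos_of_ne_zero hne))
  have h0 : ∑ χ : DirichletCharacter ℂ q, (DirichletDisc.zeroOrder χ (1 / 2) : ℝ) = 0 :=
    Finset.sum_eq_zero fun χ _ ↦ by rw [hm χ, Nat.cast_zero]
  have h := Suzuki2025Chebyshev_thm6_iv_corrected (q := q)
  rw [h0, mul_zero] at h ⊢
  exact h

/-- **The typed clause (iv), AS PRINTED, characterised**: the limit statement of clause 3 of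
`Suzuki2025Chebyshev_thm6_limits` (limit `−½ Σ_χ m_χ`, as printed in (1.28)) holds iff the GRH holds for every `χ` mod `q`
AND (`φ(q) = 1` or `Σ_χ m_χ = 0`) — by `Suzuki2025Chebyshev_thm6_iv_corrected` and uniqueness of limits. In particular the
printed (1.28) is equivalent to «GRH for all `χ` mod `q`» exactly when, under that GRH, no `L(s, χ)` vanishes at `½` or
`q ≤ 2`. (As-printed audit, recorded for the referee; nothing here bears on the truth of RH.)
[cite: Suzuki2025Chebyshev, §1.3 Thm 6 (iv) (1.28)] -/
theorem Suzuki2025Chebyshev_thm6_iv_as_printed_iff :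
    Tendsto (fun x : ℝ ↦ (1 / Real.log x) *
        ∑ n ∈ (Finset.Icc 1 ⌊x⌋₊).filter (fun n : ℕ ↦ (n : ZMod q) = 1),
          Λ n / Real.sqrt n * (1 - Real.log n / Real.log x)
        - 4 * Real.sqrt x / (Nat.totient q * Real.log x ^ 2)) atTop
      (𝓝 (-(1 / 2 : ℝ) * ∑ χ : DirichletCharacter ℂ q, (DirichletDisc.zeroOrder χ (1 / 2) : ℝ))) ↔
      (∀ χ : DirichletCharacter ℂ q, χ.RiemannHypothesis) ∧
        (Nat.totient q = 1 ∨ ∑ χ : DirichletCharacter ℂ q, (DirichletDisc.zeroOrder χ (1 / 2) : ℝ) = 0) := by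
  have hφ0 : 0 < (q.totient : ℝ) := by exact_mod_cast Nat.totient_pos.2 (NeZero.pos q)
  set S : ℝ := ∑ χ : DirichletCharacter ℂ q, (DirichletDisc.zeroOrder χ (1 / 2) : ℝ) with hS
  constructor
  · intro h
    have hGRH := forall_riemannHypothesis_of_tendsto_progressionRieszMean_div_log h
    refine ⟨hGRH, ?_⟩
    have h2 := tendsto_progressionRieszMean_div_log_of_GRH hGRH
    have heq : -(1 / 2 : ℝ) * S = -(1 / (2 * Nat.totient q) : ℝ) * S := tendsto_nhds_unique h h2
    have h3 : (-(1 / 2 : ℝ) + 1 / (2 * Nat.totient q)) * S = 0 := by linear_combination heq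
    rcases mul_eq_zero.1 h3 with h4 | h4
    · left
      have h5 : (1 : ℝ) / (2 * q.totient) = 1 / 2 := by linarith
      rw [div_eq_div_iff (by positivity) (by norm_num)] at h5
      have h6 : (q.totient : ℝ) = 1 := by linarith
      exact_mod_cast h6
    · exact Or.inr h4
  · rintro ⟨hGRH, hcase⟩
    have h2 := tendsto_progressionRieszMean_div_log_of_GRH hGRH
    have hval : -(1 / (2 * Nat.totient q) : ℝ) * S = -(1 / 2 : ℝ) * S := by
      rcases hcase with h1 | h0
      · rw [h1, Nat.cast_one, mul_one]
      · rw [h0, mul_zero, mul_zero]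
    rw [hval] at h2
    exact h2

end SuzukiThm6iv

end Literature.NumberTheory.LFunctions

end
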